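import Mathlib
import HarnessLib
import HarnessLib.Audit
import Summits.AnomalousDissipation.Statement
import Literature.Analysis.FluidPDE.LerayHopf
import Literature.Analysis.FluidPDE.ZerothLaw
import HarnessLib.Audit.Status.Attr

/-!
Route: RootDecompCycle1

# Route RootDecompCycle1 — Taylor–Green spin-up dichotomy — from-rest energy ceiling and dissipation
floor give the zeroth law

decomp-ad ROOT DECOMPOSITION, cycle 1 (cell HOME run/shared/lean/pub/decomp-ad; spine = lens-2 node
SpinUpDichotomy, CLEARED by decomp-ad-crit-1 2026-08-30T01:32:34Z, CRITIC-LEDGER.md row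
«SpinUpDichotomy (lens-2 g0)»; lens file HOME/decomp-ad-lens-2/SpinUpDichotomy.lean sha256
a61d6c31ad1df17166258c08d07028267faddc3226ae9e9a4fa63552accc58d4, NODE card sha256
b8eff7ef1cd96175c648e80b331466cc8bb2fdac8af635fd729c8d6c8c092cd0; instrument data
HOME/census/COSTUME-CENSUS-v1.md sha256
3c035e444b2e3da750236b2c0e5fdec96354a096ddab2745840b2ab63e0cdb55 (+ .json sha256
0b076466451384be7185f574a34d1ad343d8c2e4dee609b92bff40b027ec6b1b), rows ST2/WK4/IN1; DNS ledger
pub/ad-ideate/ad-ideate-p3/ROUND-9.md sha256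
999a61b1d72353a02853006458efa4e16bddad70f96d677ebfbd52d550cf6dcd, ROUND-10.md sha256
977e985d4d6e9bb5d35acd896ed02536a9cf42177b46f56a3284b821b151d2cf). It suffices to show X = «the
canonical Taylor–Green SPIN-UP decides the zeroth law»: at the pinned force f_TG = (sin2πx₀ cos2πx₁
cos2πx₂, −cos2πx₀ sin2πx₁ cos2πx₂, 0) and the pinned datum u₀ = 0, for all small ν, (CEILING) every
global Leray–Hopf solution from rest has limsup-mean energy ≤ E and (FLOOR) some global Leray–Hopf
solution from rest has limsup-mean viscous dissipation ≥ ε. X = RestMeanCeilingTG ∧ RestMeanFloorTG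
(with the closed support TaylorGreenForceRegularTG supplying the force clauses); ROOT ⟸ X by pure
logic (closes). Target = ROOT `_root_.AnomalousDissipation`; no EQUIV layer, no residual, summit
currency only.
Lean: `Summit.AnomalousDissipation.AnomalousDissipation.Theses.RootDecompCycle1.RestMeanCeilingTG ∧
Summit.AnomalousDissipation.AnomalousDissipation.Theses.RootDecompCycle1.RestMeanFloorTG`

## Assembly
Pure logic (lens-2 `closes`, re-typed by the writer with the viscosity sequence inlined): f = f_TG;
ν_j = min ν₀ ν₁ / (j+2) ↓ 0 lies below both thresholds; u₀_j = 0; u_j = the FLOOR's Leray–Hopf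
solution at ν_j; the CEILING bounds its mean energy; the support item gives smooth / div-free /
mean-zero.

Rationale: WHY THIS LINE. Lens 2 (structural dichotomy special ∣ generic): partition the summit's possible
witnesses (force × Galilean frame) into I laminar-integrable forces in the zero-mean frame
(shear/Kolmogorov, ABC: the Stokes flow from rest is THE Leray–Hopf solution — FLOOR holds with
⟨ν‖∇u‖²⟩ ~ 1/ν, CEILING fails), II swept frames (explicit steady swept shear state, bounded
uniformly in ν and quiet ⟨ν‖∇u‖²⟩ = O(ν): CEILING holds, FLOOR fails — in tree as the Galilean-drift
witness of Theorems.CorrelationEnergyUnboundedNeg_refuted, negatives 0204), III pumped forces in the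
zero-mean frame (generic; f_TG: (f_TG·∇)f_TG has nonzero Leray projection, modes (2,0,±2),(0,2,±2),
BrachetEtAl1983 §3, TaylorGreen1937) — both halves open, both measured (ROUND-9: ⟨D⟩ plateau
0.247–0.28 over ν/ν_ref = 1/32…1/512, sup-energy from rest 0.67–0.71 flat, onset t* ≈ 2
ν-independent; ROUND-10: no quiet steady symmetric state to r ≈ 1/103.6). Classes I/II are exactly
the two models that SEPARATE the halves, so «strictly weaker than S» is theorem-grade for each
piece, and the generic cell III carries the difficulty pinned to its simplest member. Imported from
dynamical-systems practice: spin-up from rest as the canonical trajectory problem (Leray–Hopf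
non-uniqueness absorbed by ∀ in the ceiling and ∃ in the floor); the energy method
(DoeringFoias2002) prices the ceiling. What it does that prior routes do not: PumpedMirror
(route-AnomalousDissipation-PumpedMirror) pins f_TG but its floor MirrorFloorTG is a state
certificate over all of Fix K (census COSTUME trap 15372, kernel-iff with summit-in-class) and its
ceiling 15373 is pathwise for SOME solution in Fix K; here both halves are trajectory statements
about the one spin-up, the floor is in DISSIPATION currency so closes reaches the root with no
regularity residual, and the cell frame A = PowerFloorFamily (writer) is reached by the proved
frame_link (lens file l.259) with no second language change (critic caveat (c)).

RANKED CRUXES. #2 RestMeanFloorTG (crux) — [crux, deciding; TAG WEAKER-operative (critic CLEARED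
2026-08-30T01:32:34Z: «∃-over-LH-from-one-datum, dissipation currency, no energy clause; separating
model class I typed; NOT the 15372 ∀-floor trap»; NECESSARY fails literally (pin), passes
operatively G2(b) with kill test); LEAF: IDEA-NEEDED + INSTRUMENTABLE (⟨D⟩ plateau 0.247–0.28 over r
= 1/32…1/512, ROUND-9 ADDENDA A–F; census rows ST2/IN1); ATTACKABLE load-bearing leaf: NONE
(declared by lens and critic caveat (a); structural reason: energy–injection coupling ⟨ν‖∇u‖²⟩ ≤
⟨(f,u)⟩, floor = flux through the forcing shell; 13-variant repair census in lens-2 NOTES §Repair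
census); BC5 rung PLAN-ONLY: ShearFromRestLoudUnbounded (class I: at f_K = sin(2πx₁)e₀ every LH
solution from rest is the Stokes flow, meanDissipation = 1/(8π²ν), meanEnergy = 1/(32π⁴ν²)) via
explicit Stokes flow + weak–strong uniqueness
Literature…NSWeakStrongUniquenessHolds.weak_strong_uniqueness_holds + Cesàro means of convergent
signals] SPIN-UP FLOOR AT f_TG: there are ε > 0 and ν₁ > 0 such that for every ν ∈ (0, ν₁) SOME
global Leray–Hopf solution from rest driven by f_TG has limsup-mean viscous dissipation ε ≤
meanDissipation ν u. KILL: a resolved ladder showing ⟨D⟩(ν) from rest decaying like ν^a (a > 0)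
beyond r = 1/512, or capture of the spin-up by a quiet bounded invariant state. [difficulty:
open-problem] (why it might fail: the TG spin-up may be captured by a quiet bounded invariant state
(laminarisation at bounded energy) or ⟨D⟩(ν) may decay like ν^a beyond ν/ν_ref = 1/512;
ClassicalEulerLimit forbids any finite-window-uniform proof (onset t* ≈ 2).) [Frisch1995,
DoeringFoias2002, doi:10.1017/s0022112083001159, TaylorGreen1937]
#3 RestMeanCeilingTG (crux) — [crux; TAG WEAKER-operative (critic CLEARED 2026-08-30T01:32:34Z:
«∀-LH-from-rest limsup-mean ceiling at the pin; not ⟹ S; separating model class II typed» =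
hard_core ENERGY AXIS, critic G5); LEAF: BARRIER/IDEA-NEEDED (no mechanism for a ν-uniform ceiling
at a pumped force is known; energy methods stop at ⟨‖u‖²⟩ ≲ ‖f‖²/ν²) + INSTRUMENTABLE (sup-energy
from rest 0.67–0.71 flat over r = 1/16…1/512, ROUND-9 ADDENDA C–F; census rows WK4/IN1); immune to
the all-data ceiling refutations negatives 2979/2984 (constant data of large mean) because the datum
is pinned to 0 and momentum is conserved; BC5 rung BY NAME:
Theorems.CorrelationEnergyUnboundedNeg_refuted (class II swept shear: a ν-uniformly bounded, quiet
explicit LH family — the ceiling shape decided TRUE where the floor fails), positive packaging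
SweptShearBoundedQuiet plan-only] SPIN-UP CEILING AT f_TG: there are E and ν₀ > 0 such that for
every ν ∈ (0, ν₀) EVERY global Leray–Hopf solution from rest driven by f_TG has limsup-mean energy
meanEnergy u ≤ E. KILL: resolved DNS or CAP showing the from-rest energy growing like ν^{-a} (a > 0)
over a further decade. [difficulty: open-problem] (why it might fail: hard-core energy axis: the
from-rest TG energy may grow like ν^{-a} as ν → 0 (condensate-type pile-up at the forcing scale); no
ν-uniform ceiling mechanism at a pumped 3-D force is known.) [DoeringFoias2002,
doi:10.1017/s0022112083001159, ConstantinTarfuleaVicol2013]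
#9 TaylorGreenForceRegularTG (support) — [support; TAG COSTUME(cite: shared item
stmt-AnomalousDissipation-15378 CLOSED — proved by
Summit.AnomalousDissipation.AnomalousDissipation.Theorems.pumpedMirror_taylorGreenForceRegularTG_proof
@ b5325d8714b8; verbatim the PumpedMirror decl so the gate deduplicates); in cone (force clauses of
closes); no leaf] The pinned Taylor–Green force is smooth, divergence-free and mean-zero.
[difficulty: provable-now] [TaylorGreen1937]

TWO-LAYER PLAN. Foreseen glued splits once evidence moves (none filed now): RestMeanFloorTG ⇐
RestMeanPowerFloorTG (spin-up POWER floor, lens aside, proved weaker via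
DoeringFoias2002_dissipation_le_power_holds: restMeanPowerFloorTG_of_floor) ∧ «no asymptotic Leray
leakage along the spin-up» (RestMeanPowerFloorTG → RestMeanFloorTG, regularity axis) — this is where
the node meets the cell frame A = PowerFloorFamily (frame_link proved in the lens file);
RestMeanCeilingTG ⇐ pathwise absorbing bound from rest (sup_t ∫‖u‖² ≤ E for small ν, PumpedMirror
15373-type but ∀-LH) ∧ the routine limsup-of-Cesàro step. First attackable rung beneath the floor
(lens/critic recommendation, banked as support later): CAP of one loud bounded invariant K-state at
fixed r = 1/16 (rigorous numerics).

KILL CRITERIA. Refutation of RestMeanFloorTG (e.g. a theorem that every LH solution from rest at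
f_TG has meanDissipation → 0 as ν → 0, or capture by a quiet bounded invariant state) closes the
route `refuted:RestMeanFloorTG` — the TG spin-up OR-branch dies, S-in-class does not. Refutation of
RestMeanCeilingTG (from-rest energy unbounded as ν → 0 at f_TG) closes it
`refuted:RestMeanCeilingTG`; pivot = another pumped force of class III or zero-momentum data other
than rest (new route, not a restate). A proof of the summit elsewhere moots it; a proof of
PumpedMirror's MirrorCertificateTG ∧ MirrorBoundedFromRestTG would supersede it.

NOT DECOMPOSED YET. Both open halves are left whole at birth (D-0019 thin route): the ceiling's
absorbing-ball / flux-balance mechanism and the floor's flux-through-the-forcing-shell mechanism are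
IDEA-NEEDED leaves; the separating models ShearFromRestLoudUnbounded (class I) and
SweptShearBoundedQuiet (class II) are typed in the lens file as ATTACKABLE asides (BC5 witnesses,
provable now) and are NOT items of this route (they are not binders of closes; bc6); the
power-currency rung RestMeanPowerFloorTG likewise. OR-siblings of this node on the cell bus (lens-1
BatchelorLogLadder CLEARED as a rung-ladder node; lens-3/4/5/6 pending or objected) are separate
files by the writer's OR-sibling policy (STATUS 01:33:08Z), never merged into this closes.

CHEAPEST FALSIFIER. One more decade of the resolved from-rest ν-ladder at f_TG (census priced test
T1, 300–600 core-h): ⟨D⟩(ν) ∝ ν^a with a > 0 kills the floor, E(ν) ∝ ν^{-a} kills the ceiling;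
either outcome is informative. Already on record (not decisive: finite ν, finite T): ⟨D⟩ plateau
0.247–0.28 and sup-energy 0.67–0.71 flat over r = 1/32…1/512 (ROUND-9 rev 7), no quiet steady
symmetric state to r ≈ 1/103.6 (ROUND-10 rev 3f).

NUMBERS. ⟨D⟩(1/128) = 0.2554, ⟨D⟩(1/256) = 0.2467 ± 0.031 (N256, k_maxη ≥ 1.31), r = 1/512:
mean_[2,3] D = 0.255; onset t* ≈ 2 ν-independent through 1/512; sup-energy from rest 0.67–0.71;
steady symmetric sheets E_s ≤ 0.517, D_s ∈ [0.255, 0.304] (ROUND-9.md sha256 999a61b1…, ROUND-10.md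
sha256 977e985d…). Print: εℓ/U³ → 0.4–0.5 (Kaneda et al. 2003, census IN1).

DEFINITION REQUESTS. None: every constant exists
(Literature.Analysis.FluidPDE.Torus.IsGlobalLerayHopf, Literature.Analysis.FluidPDE.meanEnergy,
Literature.Analysis.FluidPDE.meanDissipation, fourier, EuclideanSpace).

Novelty: Searches (2026-08-30): `rg -n "fun _ => f) 0 u"
lean/Summits/AnomalousDissipation/AnomalousDissipation/Theses/` (datum-0 pin only in PumpedMirror
pathwise-∃ Fix K and MirrorVariety stubs; 0 files with a limsup-mean ceiling ∀-over-LH-from-rest or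
a from-rest floor); 55 Theses files of the summit read by the lens and the writer; census
COSTUME-CENSUS-v1 rows ST2 (pinned-force arena routes), WK4 (saturation at zero momentum), IN1 (DNS
of the zeroth law); ledger negatives --problem AnomalousDissipation (13037, 14324, 0204, 2979, 2984,
2859 — none restated); lit: DoeringFoias2002 (energy dissipation in body-forced turbulence),
doi:10.1017/s0022112083001159 (Brachet et al. 1983, TG vortex), Frisch1995 §5.2.
Nearest prior art found: route-AnomalousDissipation-PumpedMirror (items 15372 MirrorFloorTG = census
COSTUME trap, 15373 MirrorBoundedFromRestTG pathwise ∃ in Fix K, 15378 TaylorGreenForceRegularTG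
closed) and route-AnomalousDissipation-MirrorEnsemble (17694 MirrorFamilyBoundedTG, statistical
class); in print DoeringFoias2002 (upper bounds only) and Brachet et al. 1983 (TG DNS).
Delta: first node whose two open halves are both TRAJECTORY statements about one explicit spin-up
(force f_TG, datum 0) in summit currency — ∀-ceiling / ∃-floor, the quantifier arrangement that
avoids the ∀-floor costume — reaching the root with no residual and no EQUIV layer, with typed
separating models (classes I/II) making «strictly weaker» theorem-grade for each half.
Claimed grade: new-combination  [refs: 10.1017/s0022112083001159, doi:10.1017/s0022112083001159, DoeringFoias2002, Frisch1995]

Barriers (technique_class: mechanism-pinned dichotomy, energy method, DNS-instrumented): - technique_class: mechanism-pinned dichotomy, energy method, DNS-instrumented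
- QuietRootFloorBarrier (tree file
Literature/Barriers/AnomalousDissipation/QuietRootFloorBarrier.lean, decl
QuietRootFloor.QuietRootFloorBarrier — not yet in the gate catalogue, placed here in prose): outside
— it needs a nondegenerate smooth steady Euler root of the force and concludes about floors over ALL
bounded families / invariant measures; f_TG has no smooth K-symmetric Euler root (Kelvin circuit
identity, PumpedMirror support 15374) and RestMeanFloorTG quantifies the rest trajectory only.
- Literature.Barriers.AnomalousDissipation.BrueDeLellis2023_noAnomaly_beforeEulerSingularity:
consistent, and it is WHY no finite-window-uniform argument can prove RestMeanFloorTG (dissipation →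
0 on any window on which forced Euler from rest stays smooth; DNS onset t* ≈ 2): the floor is
long-time; declared, not evaded.
- Literature.Barriers.AnomalousDissipation.Cheskidov2023_thm13_not_forceRobustNoAnomaly: outside —
it constrains force-robust ARGUMENTS; both cruxes are force-specific (pinned f_TG).
- Literature.Barriers.AnomalousDissipation.Cheskidov2023_thm21_noDissipationAnomaly: does not
quantify over these cruxes (Cheskidov 2023 uses ν-dependent forces on finite windows; fixed force,
long-time means here); it bites only the frame residual R, which this node does not use (dissipation
currency).
- Literature.Barriers.AnomalousDissipation.Marchioro1986_globalAttraction: outside — 2-D /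
gravest-shear sta

sub-problem: AnomalousDissipation · status: draft · opened planner-decomp-ad-writer-1-g0-0 2026-08-30T01:43:37Z · rev 3 · ledger route-AnomalousDissipation-RootDecompCycle1
GENERATED by the gate from the ledger (D-0016/17). Provers cite these decls: `theorem foo : Summit.AnomalousDissipation.AnomalousDissipation.Theses.RootDecompCycle1.<Decl> := …` in Summits/AnomalousDissipation/AnomalousDissipation/Theorems/<Name>.lean.
-/

namespace Summit.AnomalousDissipation.AnomalousDissipation.Theses.RootDecompCycle1

open scoped BigOperators Topology Manifold Classical MeasureTheory ProbabilityTheory Matrix InnerProductSpace ComplexConjugate ContinuousMap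
open Filter Set Function TopologicalSpace MeasureTheory

attribute [summit_statement] _root_.AnomalousDissipation

open Literature.Turb

/-- item stmt-AnomalousDissipation-24255 · crux · rank 2 · open · by planner
why it might fail: the TG spin-up may be captured by a quiet bounded invariant state (laminarisation at bounded energy) or ⟨D⟩(ν) may decay like ν^a beyond ν/ν_ref = 1/512; ClassicalEulerLimit forbids any finite-window-uniform proof (onset t* ≈ 2).
sources: Frisch1995, DoeringFoias2002, doi:10.1017/s0022112083001159, TaylorGreen1937
[crux] [crux, deciding; TAG WEAKER-operative (critic CLEARED 2026-08-30T01:32:34Z: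
«∃-over-LH-from-one-datum, dissipation currency, no energy clause; separating model class I typed;
NOT the 15372 ∀-floor trap»; NECESSARY fails literally (pin), passes operatively G2(b) with kill
test); LEAF: IDEA-NEEDED + INSTRUMENTABLE (⟨D⟩ plateau 0.247–0.28 over r = 1/32…1/512, ROUND-9
ADDENDA A–F; census rows ST2/IN1); ATTACKABLE load-bearing leaf: NONE (declared by lens and critic
caveat (a); structural reason: energy–injection coupling ⟨ν‖∇u‖²⟩ ≤ ⟨(f,u)⟩, floor = flux through
the forcing shell; 13-variant repair census in lens-2 NOTES §Repair census); BC5 rung PLAN-ONLY: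
ShearFromRestLoudUnbounded (class I: at f_K = sin(2πx₁)e₀ every LH solution from rest is the Stokes
flow, meanDissipation = 1/(8π²ν), meanEnergy = 1/(32π⁴ν²)) via explicit Stokes flow + weak–strong
uniqueness Literature…NSWeakStrongUniquenessHolds.weak_strong_uniqueness_holds + Cesàro means of
convergent signals] SPIN-UP FLOOR AT f_TG: there are ε > 0 and ν₁ > 0 such that for every ν ∈ (0,
ν₁) SOME global Leray–Hopf solution from rest driven by f_TG has limsup-mean viscous dissipation ε ≤
meanDissipation ν u. KILL: a resolved -/
@[route_item "route-AnomalousDissipation-RootDecompCycle1", crux]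
def RestMeanFloorTG : Prop :=
  ∀ f : UnitAddTorus (Fin 3) → EuclideanSpace ℝ (Fin 3), f = (fun x => !₂[(fourier 1 (x 0) : ℂ).im * (fourier 1 (x 1) : ℂ).re * (fourier 1 (x 2) : ℂ).re, -((fourier 1 (x 0) : ℂ).re * (fourier 1 (x 1) : ℂ).im * (fourier 1 (x 2) : ℂ).re), (0 : ℝ)]) → ∃ ε ν₁ : ℝ, 0 < ε ∧ 0 < ν₁ ∧ ∀ ν : ℝ, 0 < ν → ν < ν₁ → ∃ u : ℝ → UnitAddTorus (Fin 3) → EuclideanSpace ℝ (Fin 3), Literature.Analysis.FluidPDE.Torus.IsGlobalLerayHopf ν (fun _ => f) 0 u ∧ ε ≤ Literature.Analysis.FluidPDE.meanDissipation ν u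

/-- item stmt-AnomalousDissipation-24256 · crux · rank 3 · SPLIT (gen 1) into LoudRestMeanCeilingTG, QuietRestMeanCeilingTG + glue LoudQuietCeilingGlue · direct attempts still welcome (low priority) · by planner
why it might fail: hard-core energy axis: the from-rest TG energy may grow like ν^{-a} as ν → 0 (condensate-type pile-up at the forcing scale); no ν-uniform ceiling mechanism at a pumped 3-D force is known.
sources: DoeringFoias2002, doi:10.1017/s0022112083001159, ConstantinTarfuleaVicol2013
[crux] [crux; TAG WEAKER-operative (critic CLEARED 2026-08-30T01:32:34Z: «∀-LH-from-rest limsup-mean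
ceiling at the pin; not ⟹ S; separating model class II typed» = hard_core ENERGY AXIS, critic G5);
LEAF: BARRIER/IDEA-NEEDED (no mechanism for a ν-uniform ceiling at a pumped force is known; energy
methods stop at ⟨‖u‖²⟩ ≲ ‖f‖²/ν²) + INSTRUMENTABLE (sup-energy from rest 0.67–0.71 flat over r =
1/16…1/512, ROUND-9 ADDENDA C–F; census rows WK4/IN1); immune to the all-data ceiling refutations
negatives 2979/2984 (constant data of large mean) because the datum is pinned to 0 and momentum is
conserved; BC5 rung BY NAME: Theorems.CorrelationEnergyUnboundedNeg_refuted (class II swept shear: a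
ν-uniformly bounded, quiet explicit LH family — the ceiling shape decided TRUE where the floor
fails), positive packaging SweptShearBoundedQuiet plan-only] SPIN-UP CEILING AT f_TG: there are E
and ν₀ > 0 such that for every ν ∈ (0, ν₀) EVERY global Leray–Hopf solution from rest driven by f_TG
has limsup-mean energy meanEnergy u ≤ E. KILL: resolved DNS or CAP showing the from-rest energy
growing like ν^{-a} (a > 0) over a further decade. [difficulty: open-problem] -/
@[route_item "route-AnomalousDissipation-RootDecompCycle1", crux]
def RestMeanCeilingTG : Prop :=
  ∀ f : UnitAddTorus (Fin 3) → EuclideanSpace ℝ (Fin 3), f = (fun x => !₂[(fourier 1 (x 0) : ℂ).im * (fourier 1 (x 1) : ℂ).re * (fourier 1 (x 2) : ℂ).re, -((fourier 1 (x 0) : ℂ).re * (fourier 1 (x 1) : ℂ).im * (fourier 1 (x 2) : ℂ).re), (0 : ℝ)]) → ∃ E ν₀ : ℝ, 0 < ν₀ ∧ ∀ ν : ℝ, 0 < ν → ν < ν₀ → ∀ u : ℝ → UnitAddTorus (Fin 3) → EuclideanSpace ℝ (Fin 3), Literature.Analysis.FluidPDE.Torus.IsGlobalLerayHopf ν (fun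 _ => f) 0 u → Literature.Analysis.FluidPDE.meanEnergy u ≤ E

-- parent: RestMeanCeilingTG · child (gen 1)
/--     item stmt-AnomalousDissipation-33849 · crux · rank 301 · open
    parent: RestMeanCeilingTG · by planner
    why it might fail: a loud condensate at f_TG (energy ≍ ν^{-a} with non-vanishing dissipation; for a ≥ 1 Poincaré forces loudness) is budget-consistent with every LH bound; no mechanism pins the energy of a pumped 3-D force's spin-up (24256's hard core, loud half).
    sources: DoeringFoias2002, arXiv:1510.00379, Frisch1995
[crux · LOUD HALF of the energy ceiling 24256 = its LOAD-BEARING half (every `closes` of the OR-1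
family applies 24256 only to ε-loud floor witnesses; kernel closes_rootTrim / closes2A_trim /
closes) · WEAKER than 24256 (kernel loudRestMeanCeilingTG_of; strict modulo the
quiet-mild-condensate world) · exact cut 24256 ↔ C_L ∧ C_q (kernel restMeanCeilingTG_iff) · BARRIER
(G5 energy hard core, loud half) + IDEA-NEEDED · INSTRUMENTABLE-supported (ROUND-9: all archived TG
runs loud D̂≈0.25 and bounded sup-E∈[0.67,0.71]) · NOT FREE (class-I laminar alignment violates it
in kind: OR-1 BC5(ii))] LOUD SPIN-UP ENERGY CEILING AT f_TG: for every ε>0 there are E, ν₀>0 such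
that for every ν∈(0,ν₀) every global Leray–Hopf solution from rest driven by f_TG with
meanDissipation ≥ ε has meanEnergy ≤ E («loud spin-ups are bounded» ⟺ «energetic spin-ups are
quiet»). By Poincaré every spin-up with meanEnergy ≥ c/ν is 4π²c-loud, so C_L alone excludes the
whole strong-condensate range (energy grade a ∈ [1,2]); the dropped quiet half concerns only mild
quiet condensates a ∈ (0,1). [decomp-ad lens-1 g16 NODE LoadBearingTrim] [filed by
decomp-ad-writer-1 g6 as the LOAD-BEARING child of the G15 LOAD-BEARING -/
@[route_item "route-AnomalousDissipation-RootDecompCycle1"]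
def LoudRestMeanCeilingTG : Prop :=
  ∀ f : UnitAddTorus (Fin 3) → EuclideanSpace ℝ (Fin 3), f = (fun x => !₂[(fourier 1 (x 0) : ℂ).im * (fourier 1 (x 1) : ℂ).re * (fourier 1 (x 2) : ℂ).re, -((fourier 1 (x 0) : ℂ).re * (fourier 1 (x 1) : ℂ).im * (fourier 1 (x 2) : ℂ).re), (0 : ℝ)]) → ∀ ε : ℝ, 0 < ε → ∃ E ν₀ : ℝ, 0 < ν₀ ∧ ∀ ν : ℝ, 0 < ν → ν < ν₀ → ∀ u : ℝ → UnitAddTorus (Fin 3) → EuclideanSpace ℝ (Fin 3), Literature.Analysis.FluidPDE.Torus.IsGlobalLerayHopf ν (fun _ => f) 0 u → ε ≤ Literature.Analysis.FluidPDE.meanDissipation ν u → Literature.Analysis.FluidPDE.meanEnergy u ≤ E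

-- parent: RestMeanCeilingTG · child (gen 1)
/--     item stmt-AnomalousDissipation-33850 · aside · rank 302 · open
    parent: RestMeanCeilingTG · by planner
    why it might fail: mild quiet condensate: gravest-mode energy 1 ≪ E ≪ ν^{-1} sustained by an O(νE) net inverse transfer, dissipation 4π²νE → 0 — budget-consistent; irrelevant to S either way (dead half).
    sources: DoeringFoias2002, arXiv:1510.00379, Frisch1995
[aside · DEAD HALF of 24256 — consumed by NO deciding theorem of the OR-1 family (kernel
closes_rootTrim, closes2A_trim) · typed only to certify the exact cut restMeanCeilingTG_iff · never
staffed · not free both ways UNDECIDED (mild quiet condensates, energy grade a∈(0,1) at the gravest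
modes, are budget-consistent; no in-kind witness of failure)] QUIET SPIN-UP ENERGY CEILING AT f_TG:
there are ε, ν₀ > 0 and E such that for every ν∈(0,ν₀) every global LH solution from rest driven by
f_TG with meanDissipation < ε has meanEnergy ≤ E. [DEAD HALF — consumed by no closes — DO NOT STAFF
(crit-1 g3 14:31:48Z / 14:42:31Z); typed only so that the split glue LoudRestMeanCeilingTG →
QuietRestMeanCeilingTG → RestMeanCeilingTG is exact (kernel restMeanCeilingTG_iff, lens-1 g16)] -/
@[route_item "route-AnomalousDissipation-RootDecompCycle1"]
def QuietRestMeanCeilingTG : Prop :=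
  ∀ f : UnitAddTorus (Fin 3) → EuclideanSpace ℝ (Fin 3), f = (fun x => !₂[(fourier 1 (x 0) : ℂ).im * (fourier 1 (x 1) : ℂ).re * (fourier 1 (x 2) : ℂ).re, -((fourier 1 (x 0) : ℂ).re * (fourier 1 (x 1) : ℂ).im * (fourier 1 (x 2) : ℂ).re), (0 : ℝ)]) → ∃ ε E ν₀ : ℝ, 0 < ε ∧ 0 < ν₀ ∧ ∀ ν : ℝ, 0 < ν → ν < ν₀ → ∀ u : ℝ → UnitAddTorus (Fin 3) → EuclideanSpace ℝ (Fin 3), Literature.Analysis.FluidPDE.Torus.IsGlobalLerayHopf ν (fun _ => f) 0 u → Literature.Analysis.FluidPDE.meanDissipation ν u < ε → Literature.Analysis.FluidPDE.meanEnergy u ≤ E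

-- parent: RestMeanCeilingTG · glue (gen 1)
/--     item stmt-AnomalousDissipation-33851 · support · rank 303 · closed · proved by Summit.AnomalousDissipation.AnomalousDissipation.Theorems.LoadBearingTrimGlue.loudQuietCeilingGlue_holds (prover)
    parent: RestMeanCeilingTG · GLUE: children ⟹ parent · by planner
[glue · PROVABLE NOW — PROVED in the lens-1 g16 kernel as restMeanCeilingTG_iff.mpr
(HOME/decomp-ad-lens-1/g16/LoadBearingTrim.lean sha256 c0ba9eaf5e5b…, 0 sorry): recombination at the
quiet half's threshold ε_q — take C_L's (E_L, ν_L) at ε_q and C_q's (E_q, ν_q), then E := max E_L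
E_q, ν₀ := min ν_L ν_q, and every LH solution from rest is either ε_q-loud (C_L) or ε_q-quiet (C_q).
G15 LOAD-BEARING TRIM (crit-1 g3 2026-08-30T14:31:48Z): E13 type (i) cut of the ∀-ceiling 24256 at a
FREE loudness threshold; the loud child is the half every `closes` of the OR-1 family actually
visits (OR-1 l.258ff / 2A l.465ff apply hC' only to the floor witness; StrainDichotomy /
OsgoodStrain / KolmogorovPincer factor through them), the quiet child is the dead half (aside, never
staffed). Port target: Theorems/RootDecompCycle1LoudQuietCeilingGlue.lean.] -/
@[route_item "route-AnomalousDissipation-RootDecompCycle1"]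
def LoudQuietCeilingGlue : Prop :=
  LoudRestMeanCeilingTG → QuietRestMeanCeilingTG → RestMeanCeilingTG

-- `LoudQuietCeilingGlue` holds: proved by `Summit.AnomalousDissipation.AnomalousDissipation.Theorems.LoadBearingTrimGlue.loudQuietCeilingGlue_holds` (its module imports this route file, so no `_holds` link can be stated here).

/-- item stmt-AnomalousDissipation-24257 · support · rank 9 · closed · proved by Summit.AnomalousDissipation.AnomalousDissipation.Theorems.TaylorGreenForceRegular.rootDecompCycle1_taylorGreenForceRegularTG (prover) · by planner
sources: TaylorGreen1937
[support] [support; TAG COSTUME(cite: shared item stmt-AnomalousDissipation-15378 CLOSED — proved by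
Summit.AnomalousDissipation.AnomalousDissipation.Theorems.pumpedMirror_taylorGreenForceRegularTG_proof
@ b5325d8714b8; verbatim the PumpedMirror decl so the gate deduplicates); in cone (force clauses of
closes); no leaf] The pinned Taylor–Green force is smooth, divergence-free and mean-zero.
[difficulty: provable-now] -/
@[route_item "route-AnomalousDissipation-RootDecompCycle1", crux]
def TaylorGreenForceRegularTG : Prop :=
  ∀ f : UnitAddTorus (Fin 3) → EuclideanSpace ℝ (Fin 3), f = (fun x => !₂[(fourier 1 (x 0) : ℂ).im * (fourier 1 (x 1) : ℂ).re * (fourier 1 (x 2) : ℂ).re, -((fourier 1 (x 0) : ℂ).re * (fourier 1 (x 1) : ℂ).im * (fourier 1 (x 2) : ℂ).re), (0 : ℝ)]) → Literature.Analysis.FunctionSpaces.Torus.IsSmooth f ∧ Literature.Analysis.FunctionSpaces.Torus.IsDivFree f ∧ Literature.Analysis.FunctionSpaces.Torus.HasZeroMean f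

-- `TaylorGreenForceRegularTG` holds: proved by `Summit.AnomalousDissipation.AnomalousDissipation.Theorems.TaylorGreenForceRegular.rootDecompCycle1_taylorGreenForceRegularTG` (its module imports this route file, so no `_holds` link can be stated here).

/-- item stmt-AnomalousDissipation-24258 · assembly · rank 1 · open · by planner
sources: Frisch1995
[assembly] TaylorGreenForceRegularTG → RestMeanCeilingTG → RestMeanFloorTG → the zeroth law. -/
@[route_item "route-AnomalousDissipation-RootDecompCycle1"]
def Assembly : Prop :=
  TaylorGreenForceRegularTG → RestMeanCeilingTG → RestMeanFloorTG → _root_.AnomalousDissipation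

/-! D-0027 §2.1 — DECIDING THEOREM (planner-authored via `route open/edit --closes-file`; by planner-decomp-ad-writer-1-g0-0 2026-08-30T01:43:37Z):
its hypotheses are this route's items and its conclusion the sub-problem Statement (glue_lint), and it elaborates with this file. -/

@[closes "route-AnomalousDissipation-RootDecompCycle1"] theorem closes (hF : TaylorGreenForceRegularTG) (hC : RestMeanCeilingTG) (hD : RestMeanFloorTG) :
    _root_.AnomalousDissipation := by
  obtain ⟨hs, hd, hz⟩ := hF _ rfl
  obtain ⟨E, ν₀, hν₀, hC'⟩ := hC _ rfl
  obtain ⟨ε, ν₁, hε, hν₁, hD'⟩ := hD _ rfl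
  -- a vanishing positive viscosity sequence below both thresholds: ν_j := min ν₀ ν₁ / (j + 2)
  have hm : 0 < min ν₀ ν₁ := lt_min hν₀ hν₁
  have hden : ∀ j : ℕ, (1 : ℝ) < (j : ℝ) + 2 := fun j => by
    have h0 : (0 : ℝ) ≤ (j : ℝ) := Nat.cast_nonneg j
    linarith
  have hνpos : ∀ j : ℕ, 0 < min ν₀ ν₁ / ((j : ℝ) + 2) := fun j =>
    div_pos hm (by linarith [hden j])
  have hν0 : Filter.Tendsto (fun j : ℕ => min ν₀ ν₁ / ((j : ℝ) + 2)) Filter.atTop (nhds 0) :=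
    tendsto_const_nhds.div_atTop
      (Filter.tendsto_atTop_add_const_right _ _ tendsto_natCast_atTop_atTop)
  have hνa : ∀ j : ℕ, min ν₀ ν₁ / ((j : ℝ) + 2) < ν₀ := fun j =>
    (div_lt_self hm (hden j)).trans_le (min_le_left _ _)
  have hνb : ∀ j : ℕ, min ν₀ ν₁ / ((j : ℝ) + 2) < ν₁ := fun j =>
    (div_lt_self hm (hden j)).trans_le (min_le_right _ _)
  choose u hu using fun j : ℕ => hD' (min ν₀ ν₁ / ((j : ℝ) + 2)) (hνpos j) (hνb j)
  exact ⟨_, hs, hd, hz, fun j : ℕ => min ν₀ ν₁ / ((j : ℝ) + 2), fun _ => 0, u, hνpos, hν0,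
    fun j => (hu j).1, ⟨E, fun j => hC' _ (hνpos j) (hνa j) (u j) (hu j).1⟩, ε, hε,
    fun j => (hu j).2⟩

end Summit.AnomalousDissipation.AnomalousDissipation.Theses.RootDecompCycle1
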